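import Summits.ABC.IUTFork.Conditional.FreyLegendreP6N3SmallA
import Summits.ABC.IUTFork.Conditional.FreyLegendreP6N3T283
import Summits.ABC.IUTFork.Conditional.FreyLegendreAdmissibleList
import Summits.ABC.IUTFork.Conditional.AbcOfSHwindowFreyRefutationP6Tier2
import Literature.NumberTheory.EllipticCurves.OpenImage
import HarnessLib

/-!
# (P6) and NON-EMPTINESS of the genuine datum type at EVERY prime level for the Frey–Legendre carriers of R-W rows 6–8
# (73-triple `73 + 2¹³7⁷941² = 3¹⁶103³127`, 283-triple `283 + 5¹¹13² = 2⁸3⁸17³`): unconditional at the named exceptional levels,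
# and at every prime level modulo MAZUR 1978 Thm 1 BY NAME

PROOF-ONLY file (D-0012; 0 definitions, 0 `Prop` facts, no instance, no notation) of the abc-iut cell — D-0079 RESCUE sub-cell R-W
«WINDOW Θ-SIDE INEQUALITY», seat abc-iut-W-row-2 (gen 7), row-bound companion «W:P6-EVERY-LEVEL» of MINT-LIST W BATCH 2 row
«W-row-2» (HOME/plan/rescue/R-W/OPEN-10.md rows 6–8: `pilotDataOfK:frey-73-…:73 / :127`, `pilotDataOfK:frey-283-…:283`).

WHY. The S_H verdicts of record on these two carriers are `∀ T` theorems at EVERY prime level (FINDINGS §S / §T.2: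
`WRow.licence_frey73_all` every prime `l ≥ 29`, `WRow.licence_frey73_small` `l ∈ {5,7,17,23}`, REFUTED at `l = 11, 13`
(`GenuineK.not_pilotKummerCompatHull_chosen_frey73_eleven/_thirteen`), type-split at `19`; the 283-triple at every level), whereas the
NON-EMPTINESS of the datum type `Cor22.ThetaVolumeDatumAt (ratPoint λ) l` over which they quantify was in kernel only at the TABULATED
levels (abc-iut-w6-d102 «C:P6-KERNEL-N3»: `FreyP6T73.condP6_tabulated` `l ∈ {73, 127}`, `FreyP6T283.condP6_tabulated` 73 primes
`13 ≤ l ≤ 397`; abc-iut-L6-t15 `condP6_nineteen` at `λ₇₃`). A `∀ T` verdict over an empty type says nothing; this file removes that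
caveat at every prime level.

WHAT IS PROVED (namespace `Summit.ABC.IUTFork.Conditional`; `E₁ = [0, −(c²+ac), 0, ac³, 0]` the integer model of `y² = x(x−1)(x−λ)`):
* §1 ENGINE VARIANTS (any Frey–Legendre datum `λ = a/c`): `FreyP6Engine.condP6_ratPoint_of_irreducible` — w6-d102's engine
  `FreyP6Engine.condP6_ratPoint_of_certificate` with the Frobenius certificate replaced by the HYPOTHESIS «`ρ̄_{E₁,l}` irreducible over
  `ℚ`» from any source; `FreyP6Engine.condP6_ratPoint_of_mazur` — that hypothesis discharged by **Mazur 1978, Thm 1 BY NAME**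
  (the tree's NAMED classical fact `Literature.NumberTheory.EllipticCurves.mazur_isogeny_irreducible : Prop`, taken as a hypothesis
  `hM`; it is NOT proved in the tree, so every consumer of `hM` is a CONDITIONAL result): for every prime `l ∤ 46080` outside
  `mazurPrimes = {2,3,5,7,11,13,17,19,37,43,67,163}` and ONE multiplicative prime `q ∤ l` of `E₁` with `l ∤ ord_q Δ(E₁)`,
  `Cor22.CondP6 (ratPoint λ) l`.
* §2 THE 73-TRIPLE, UNCONDITIONAL at the eight exceptional levels `{11, 13, 17, 19, 37, 43, 67, 163}`: `FreyP6T73.condP6_exceptional`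
  by TWO Frobenius certificates — `p = 19` (`a₁₉ = 4`, tree theorem `FreyP6T73.frobeniusTrace_19`; `X² − 4X + 19` root-free mod
  `l ∈ {11, 13, 37, 43, 67, 163}`) and the NEW `p = 11` (`E₁ mod 11 = [0,1,0,9,0]`, `#Ẽ₁(𝔽₁₁) = 8` by Euler's criterion in the kernel,
  `a₁₁ = 4`; `X² − 4X + 11` root-free mod `l ∈ {13, 17, 19}`), multiplicative prime `7` (`ord₇ Δ(E₁) = 14`); hence
  `FreyP6T73.nonempty_thetaVolumeDatumAt_exceptional` (`UP`, `AdmitsCore`, (P2), (P5) decided by `FreyAdm.…_triple_list`). In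
  particular the REFUTED levels `l = 11, 13` of FINDINGS §T.2 and the small INHABITED levels `17, 19` are NON-VACUOUS, unconditionally.
* §3 THE 73-TRIPLE AT EVERY PRIME LEVEL `l ≥ 11`, modulo `hM`: `FreyP6T73.condP6_every_of_mazur`,
  `FreyP6T73.nonempty_thetaVolumeDatumAt_every_of_mazur` (`l ∈ mazurPrimes` ⇒ §2; else §1). (`l = 5` lies outside the engine —
  `5 ∣ 46080 = [F:ℚ]`-bound; `l = 7` fails (P2): `7 ∣ e₇ = 14`.)
* §4 THE 283-TRIPLE AT EVERY PRIME LEVEL `l ≥ 13`, modulo `hM`: `FreyP6T283.condP6_every_of_mazur`,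
  `FreyP6T283.nonempty_thetaVolumeDatumAt_every_of_mazur` (`l ≤ 397` ⇒ tabulated, UNCONDITIONAL BY NAME; `l > 397` ⇒ §1 with the
  multiplicative prime `5`, `ord₅ Δ(E₁) = 22`). (`l = 11` is outside: (P2) fails there, `11 ∣ e₅ = 22`; no emptiness theorem claimed.)

K2 (C-R66 (c)): seat folder `work/ap.py` (two code paths: `y`-enumeration and Euler-criterion column sum) reproduces the tree's recorded
reductions at `p = 19` (both carriers), `23`, `29` (283-triple) and gives the new `p = 11` line; the kernel's `decide` is the arbiter.

HONEST SCOPE: classical, undisputed arithmetic of two elliptic curves over `ℚ` (a Tate transvection, two point counts) plus ONE NAMED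
classical theorem (Mazur 1978, Thm 1) taken as a hypothesis where stated; «inhabited» = OUR typed datum type has an element
(non-vacuity of the `∀ T` rows); nothing about [IUTchIII] Cor. 3.12 / [IUTchIV] Thm. 1.10 in print or the truth of any S_H; no side
taken on any author; typed ≠ proved; refuted-as-typed / inhabited-as-typed ≠ in print; NO abc claim.
[cite: Mochizuki2012, IUTchIV Cor. 2.2 (ii) proof (P2)(P5)(P6)(P7) p. 45–46; IUTchI Def. 3.1 (c) p. 62] [cite: Mazur1978, Thm 1; §6 Prop. 6.3 (1) p. 153]
[cite: Serre1972PointsOrdreFini, §2 Prop. 15] [cite: MochizukiGenEll2010, Lem. 3.1 (iii) p. 14] [cite: SilvermanAEC2009, VII.5 Prop. 5.1(b), III.1 Table 3.1]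
[claim: Mochizuki2012, status: disputed] for every IUT sentence quoted.
-/

noncomputable section

open scoped Classical
open WeierstrassCurve

namespace Summit.ABC.IUTFork.Conditional

open Literature.NumberTheory.EllipticCurves Literature.NumberTheory.DiophantineGeometry.GenEll
open Literature.NumberTheory.DiophantineGeometry Literature.IUT.LogVolume Literature.IUT.LogVolume.Cor22

/-! ## §0 Two arithmetic helpers on a symbolic prime level (`l ∤ 46080` for a prime `l ≥ 7` is the tree's `FreyRef.not_dvd_46080_of_seven_le`) -/

/-- A prime `l ≥ 11` divides none of `2, 4, 6, 8, 14, 16, 18, 32` (the exponents `e_p = 2·v_p(abc)` / `e_2 − 8` of the two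
carriers below and `ord₇ Δ` of the first model): all their prime factors are `< 11`. [folklore] -/
theorem FreyP6Engine.not_dvd_of_prime_ge_eleven {l m : ℕ} (hl : l.Prime) (h11 : 11 ≤ l)
    (hm : m ∈ ([2, 4, 6, 8, 14, 16, 18, 32] : List ℕ)) : ¬ l ∣ m := by
  intro h
  have hle : l ≤ m := Nat.le_of_dvd (by fin_cases hm <;> norm_num) h
  fin_cases hm <;> interval_cases l <;> first | omega | exact absurd hl (by norm_num)

/-- A prime `l ≥ 13` does not divide `22 = 2·11` (`e_5` of the 283-triple, `ord₅ Δ` of its model). [folklore] -/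
theorem FreyP6Engine.not_dvd_22_of_prime_ge_thirteen {l : ℕ} (hl : l.Prime) (h13 : 13 ≤ l) : ¬ l ∣ 22 := by
  intro h
  have hle : l ≤ 22 := Nat.le_of_dvd (by norm_num) h
  interval_cases l <;> first | omega | exact absurd hl (by norm_num)

namespace FreyP6Engine

/-! ## §1 Engine variants: irreducibility as a hypothesis / from Mazur 1978 Thm 1 BY NAME -/

/-- **(P6) ENGINE, irreducibility as a HYPOTHESIS.** Let `λ = a/c` (`a, c ≠ 0`, `a ≠ c`), `E₁ = [0, −(c²+ac), 0, ac³, 0]`, `l ∤ 46080`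
a prime. GIVEN (i) `ρ̄_{E₁,l}` irreducible over `ℚ` (`HasIrreducibleModPGaloisRep`, from any source) and (ii) a prime `q ∤ l` with
`q ∤ c₄(E₁)`, `Δ(E₁) = q^k·D`, `q ∤ D`, `k ≥ 1`, `l ∤ k` (multiplicative place, Tate transvection), THEN `Cor22.CondP6 (ratPoint λ) l`
— abc-iut-w6-d102's `condP6_ratPoint_of_certificate` with its first step abstracted. [cite: Mochizuki2012, IUTchIV Cor. 2.2 (ii) (P6) p.46]
[cite: MochizukiGenEll2010, Lem 3.1 (iii) p.14] -/
theorem condP6_ratPoint_of_irreducible (a c : ℕ) (ha : a ≠ 0) (hc : c ≠ 0) (hac : a ≠ c)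
    (l : ℕ) [Fact l.Prime] (h46080 : ¬ l ∣ 46080)
    (hirr : (((⟨0, -(((c : ℕ) : ℤ) ^ 2 + (a : ℕ) * (c : ℕ)), 0, ((a : ℕ) : ℤ) * ((c : ℕ) : ℤ) ^ 3, 0⟩ : WeierstrassCurve ℤ)).map
        (Int.castRingHom ℚ)).HasIrreducibleModPGaloisRep l)
    (q : ℕ) (hq : q.Prime) (hql : ¬ q ∣ l)
    (hc4 : ¬ (q : ℤ) ∣ ((⟨0, -(((c : ℕ) : ℤ) ^ 2 + (a : ℕ) * (c : ℕ)), 0, ((a : ℕ) : ℤ) * ((c : ℕ) : ℤ) ^ 3, 0⟩ : WeierstrassCurve ℤ)).c₄)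
    (k : ℕ) (hk0 : 0 < k) (hk : ¬ l ∣ k) (D : ℤ)
    (hΔ : ((⟨0, -(((c : ℕ) : ℤ) ^ 2 + (a : ℕ) * (c : ℕ)), 0, ((a : ℕ) : ℤ) * ((c : ℕ) : ℤ) ^ 3, 0⟩ : WeierstrassCurve ℤ)).Δ = q ^ k * D)
    (hD : ¬ (q : ℤ) ∣ D) :
    Cor22.CondP6 (ratPoint (((a : ℕ) : ℚ) / (c : ℕ))) l := by
  intro hU F _ _ iA hF _
  set E : WeierstrassCurve ℤ :=
    ⟨0, -(((c : ℕ) : ℤ) ^ 2 + (a : ℕ) * (c : ℕ)), 0, ((a : ℕ) : ℤ) * ((c : ℕ) : ℤ) ^ 3, 0⟩ with hEdef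
  have hDne : D ≠ 0 := fun h0 => hD (h0 ▸ dvd_zero _)
  have hE : E.Δ ≠ 0 := by
    rw [hΔ]
    exact mul_ne_zero (pow_ne_zero _ (by exact_mod_cast hq.ne_zero)) hDne
  -- `⊇ SL₂(𝔽_l)` over `ℚ` for the integer model, then for the Legendre model
  have hmodel := imageModLContainsSL2_map E hE l hirr q hq hql hc4 k hk0 hk D hΔ hD
  have hleg := @EllPoint.imageModLContainsSL2_of_variableChange_eq ℚ _ _ _ _
    (Summit.BirchSwinnertonDyer.Rank2.isElliptic_map_of_Δ_ne_zero E hE) (isElliptic_legendre a c ha hc hac) _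
    (variableChange_model_eq_legendre a c hc) l _ hmodel
  -- `[F : ℚ] ∣ 46080` is prime to `l`
  have hdeg : ¬ l ∣ Module.finrank (ratPoint (((a : ℕ) : ℚ) / (c : ℕ))).F F :=
    fun h => h46080 (h.trans hF.finrank_dvd)
  -- UP from `ℚ` to the Galois extension `F`
  have hup := @EllPoint.imageModLContainsSL2_map_of_isGalois_of_not_dvd
    (@EllPoint.mk ℚ _ _ (⟨0, -(1 + ((a : ℕ) : ℚ) / (c : ℕ)), 0, ((a : ℕ) : ℚ) / (c : ℕ), 0⟩ : WeierstrassCurve ℚ)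
      (isElliptic_legendre a c ha hc hac)) F _ _ iA l _ hF.isGalois hdeg hleg
  -- the base-changed Legendre model is `thetaCurve P F`
  have hW : (1 : VariableChange F) •
      ((⟨0, -(1 + ((a : ℕ) : ℚ) / (c : ℕ)), 0, ((a : ℕ) : ℚ) / (c : ℕ), 0⟩ : WeierstrassCurve ℚ).map (@algebraMap ℚ F _ _ iA)) =
      Cor22.thetaCurve (ratPoint (((a : ℕ) : ℚ) / (c : ℕ))) F := by
    rw [one_smul]
    ext <;> simp [ratPoint, WeierstrassCurve.map]
  exact @EllPoint.imageModLContainsSL2_of_variableChange_eq F _ _ _ _ (_) (Cor22.thetaCurve_isElliptic hU F) 1 hW l _ hup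

/-- **(P6) ENGINE modulo MAZUR 1978 Thm 1 BY NAME.** For `λ = a/c` as above, a prime `l ∤ 46080` OUTSIDE Mazur's list
`{2,3,5,7,11,13,17,19,37,43,67,163}` and one multiplicative prime `q ∤ l` of `E₁` with `l ∤ ord_q Δ(E₁)`: `Cor22.CondP6 (ratPoint λ) l`,
CONDITIONALLY on the tree's named fact `mazur_isogeny_irreducible` (no `ℚ`-rational `l`-isogeny ⇒ `ρ̄_l` irreducible), which is NOT
proved in the tree. [cite: Mazur1978, Thm 1] [cite: Mochizuki2012, IUTchIV Cor. 2.2 (ii) (P6) p.46] -/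
theorem condP6_ratPoint_of_mazur (hM : mazur_isogeny_irreducible) (a c : ℕ) (ha : a ≠ 0) (hc : c ≠ 0) (hac : a ≠ c)
    (l : ℕ) [Fact l.Prime] (h46080 : ¬ l ∣ 46080) (hlM : l ∉ mazurPrimes)
    (q : ℕ) (hq : q.Prime) (hql : ¬ q ∣ l)
    (hc4 : ¬ (q : ℤ) ∣ ((⟨0, -(((c : ℕ) : ℤ) ^ 2 + (a : ℕ) * (c : ℕ)), 0, ((a : ℕ) : ℤ) * ((c : ℕ) : ℤ) ^ 3, 0⟩ : WeierstrassCurve ℤ)).c₄)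
    (k : ℕ) (hk0 : 0 < k) (hk : ¬ l ∣ k) (D : ℤ)
    (hΔ : ((⟨0, -(((c : ℕ) : ℤ) ^ 2 + (a : ℕ) * (c : ℕ)), 0, ((a : ℕ) : ℤ) * ((c : ℕ) : ℤ) ^ 3, 0⟩ : WeierstrassCurve ℤ)).Δ = q ^ k * D)
    (hD : ¬ (q : ℤ) ∣ D) :
    Cor22.CondP6 (ratPoint (((a : ℕ) : ℚ) / (c : ℕ))) l := by
  set E : WeierstrassCurve ℤ :=
    ⟨0, -(((c : ℕ) : ℤ) ^ 2 + (a : ℕ) * (c : ℕ)), 0, ((a : ℕ) : ℤ) * ((c : ℕ) : ℤ) ^ 3, 0⟩ with hEdef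
  have hDne : D ≠ 0 := fun h0 => hD (h0 ▸ dvd_zero _)
  have hE : E.Δ ≠ 0 := by
    rw [hΔ]
    exact mul_ne_zero (pow_ne_zero _ (by exact_mod_cast hq.ne_zero)) hDne
  haveI := Summit.BirchSwinnertonDyer.Rank2.isElliptic_map_of_Δ_ne_zero E hE
  have hirr : (E.map (Int.castRingHom ℚ)).HasIrreducibleModPGaloisRep l := hM _ l (Fact.out) hlM
  exact condP6_ratPoint_of_irreducible a c ha hc hac l h46080 hirr q hq hql hc4 k hk0 hk D hΔ hD

/-- For a prime `l`, `l ∉ mazurPrimes` as soon as `l` differs from the twelve listed primes — in particular for every prime `l > 163`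
(`not_mem_mazurPrimes_of_lt`) and for every prime `l ≥ 11` outside `{11, 13, 17, 19, 37, 43, 67, 163}`. [cite: Mazur1978, Thm 1] -/
theorem not_mem_mazurPrimes_of_not_mem {l : ℕ} (h11 : 11 ≤ l)
    (h : l ∉ ([11, 13, 17, 19, 37, 43, 67, 163] : List ℕ)) : l ∉ mazurPrimes := by
  intro hmem
  simp only [mazurPrimes, Finset.mem_insert, Finset.mem_singleton] at hmem
  simp only [List.mem_cons, List.not_mem_nil, or_false, not_or] at h
  omega

end FreyP6Engine

/-! ## §2 The 73-triple `73 + 2¹³·7⁷·941² = 3¹⁶·103³·127`, `λ₇₃ = 73/5973865915867209`: UNCONDITIONAL at the eight exceptional levels -/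

namespace FreyP6T73

/-- `E₁ mod 11 = [0, 1, 0, 9, 0]`. [folklore] -/
theorem model_map_11 :
    ((
      ⟨0, -(((5973865915867209 : ℕ) : ℤ) ^ 2 + (73 : ℕ) * (5973865915867209 : ℕ)), 0,
        ((73 : ℕ) : ℤ) * ((5973865915867209 : ℕ) : ℤ) ^ 3, 0⟩ : WeierstrassCurve ℤ)).map (Int.castRingHom (ZMod 11)) = ⟨0, 1, 0, 9, 0⟩ := by
  ext <;> decide +kernel

/-- `a_11(E₁) = 11 + 1 − #Ẽ₁(𝔽_11) = 12 − 8 = 4` — the point count `#Ẽ₁(𝔽_11) = 8` of `y² = x³ + x² + 9x` is a KERNEL computation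
(Euler's criterion, `card_sol_eq_sum_euler` / `natCard_point_eq_one_add_card`). [folklore] -/
theorem frobeniusTrace_11 : Literature.NumberTheory.Automorphic.frobeniusTrace
    (
      ⟨0, -(((5973865915867209 : ℕ) : ℤ) ^ 2 + (73 : ℕ) * (5973865915867209 : ℕ)), 0,
        ((73 : ℕ) : ℤ) * ((5973865915867209 : ℕ) : ℤ) ^ 3, 0⟩ : WeierstrassCurve ℤ) 11 = 4 := by
  have hc : Nat.card (⟨0, 1, 0, 9, 0⟩ : WeierstrassCurve (ZMod 11)).toAffine.Point = 8 := by
    rw [@WeierstrassCurve.natCard_point_eq_one_add_card (ZMod 11) (@ZMod.instField 11 ⟨by norm_num⟩) _ _ _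
      (by decide +kernel), @card_sol_eq_sum_euler (ZMod 11) (@ZMod.instField 11 ⟨by norm_num⟩) _ _
      (by rw [ZMod.ringChar_zmod_n]; decide)]
    decide +kernel
  rw [Literature.NumberTheory.Automorphic.frobeniusTrace, Literature.NumberTheory.Automorphic.numPointsMod,
    model_map_11, hc]; norm_num

/-- `11 ∤ Δ(E₁)` (`11` is a good prime of the 73-triple's model). [folklore] -/
theorem not_dvd_Δ_11 : ¬ ((11 : ℕ) : ℤ) ∣ ((
      ⟨0, -(((5973865915867209 : ℕ) : ℤ) ^ 2 + (73 : ℕ) * (5973865915867209 : ℕ)), 0,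
        ((73 : ℕ) : ℤ) * ((5973865915867209 : ℕ) : ℤ) ^ 3, 0⟩ : WeierstrassCurve ℤ)).Δ := by
  rw [FreyP6Engine.Δ_model]; norm_num

/-- **(P6) at `λ₇₃` for `l ∈ {13, 17, 19}`** — multiplicative prime `7` (`ord₇ Δ = 14`, tree lemmas `Δ_eq_7`, `not_dvd_c₄_7`,
`not_dvd_D_7` BY NAME), NEW Frobenius certificate `p = 11` (`a₁₁ = 4`; `X² − 4X + 11` root-free mod `13, 17, 19`: ONE kernel `decide`).
[cite: Mochizuki2012, IUTchIV Cor. 2.2 (ii) (P6) p.46] [cite: Mazur1978, §6 Prop. 6.3 (1) p. 153] -/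
theorem condP6_of_mem_q7_p11 :
    ∀ l ∈ ([13, 17, 19] : List ℕ),
      Cor22.CondP6 (ratPoint (((73 : ℕ) : ℚ) / (5973865915867209 : ℕ))) l :=
  FreyP6Engine.condP6_ratPoint_of_certificate_list (73) (5973865915867209) (by norm_num) (by norm_num) (by norm_num)
    7 (by norm_num) not_dvd_c₄_7 14 (by norm_num) _ Δ_eq_7 not_dvd_D_7 11 (by norm_num) not_dvd_Δ_11 4 frobeniusTrace_11
    [13, 17, 19] (by decide +kernel) (by decide +kernel)

/-- **(P6) at `λ₇₃` for `l ∈ {11, 13, 37, 43, 67, 163}`** — multiplicative prime `7`, the TREE's Frobenius certificate `p = 19`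
(`a₁₉ = 4`, `FreyP6T73.frobeniusTrace_19` BY NAME; `X² − 4X + 19` root-free mod `l` iff `(−15/l) = −1`).
[cite: Mochizuki2012, IUTchIV Cor. 2.2 (ii) (P6) p.46] [cite: Mazur1978, §6 Prop. 6.3 (1) p. 153] -/
theorem condP6_of_mem_q7_p19_exceptional :
    ∀ l ∈ ([11, 13, 37, 43, 67, 163] : List ℕ),
      Cor22.CondP6 (ratPoint (((73 : ℕ) : ℚ) / (5973865915867209 : ℕ))) l :=
  FreyP6Engine.condP6_ratPoint_of_certificate_list (73) (5973865915867209) (by norm_num) (by norm_num) (by norm_num)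
    7 (by norm_num) not_dvd_c₄_7 14 (by norm_num) _ Δ_eq_7 not_dvd_D_7 19 (by norm_num) not_dvd_Δ_19 4 frobeniusTrace_19
    [11, 13, 37, 43, 67, 163] (by decide +kernel) (by decide +kernel)

/-- **(P6) HOLDS at `λ₇₃` at EVERY Mazur prime `l ≥ 11`, UNCONDITIONALLY: `l ∈ {11, 13, 17, 19, 37, 43, 67, 163}`** (two certificates).
[cite: Mochizuki2012, IUTchIV Cor. 2.2 (ii) (P6) p.46] -/
theorem condP6_exceptional :
    ∀ l ∈ ([11, 13, 17, 19, 37, 43, 67, 163] : List ℕ),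
      Cor22.CondP6 (ratPoint (((73 : ℕ) : ℚ) / (5973865915867209 : ℕ))) l := by
  intro l hl
  by_cases h : l ∈ ([13, 17, 19] : List ℕ)
  · exact condP6_of_mem_q7_p11 l h
  · have h' : l ∈ ([11, 13, 37, 43, 67, 163] : List ℕ) := by
      simp only [List.mem_cons, List.not_mem_nil, or_false, not_or] at hl h ⊢
      omega
    exact condP6_of_mem_q7_p19_exceptional l h'

/-- **The datum type over `λ₇₃` is INHABITED at every exceptional level `l ∈ {11, 13, 17, 19, 37, 43, 67, 163}`, UNCONDITIONALLY** —
`UP`, `AdmitsCore`, (P2), (P5) decided from `abc = ∏ p^{e_p}` over `[2, 3, 7, 73, 103, 127, 941]`, `e = [26, 32, 14, 2, 6, 2, 4]`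
(`FreyAdm.nonempty_thetaVolumeDatumAt_triple_list`), (P6) = `condP6_exceptional`. In particular FINDINGS §T.2's REFUTED levels
`11, 13` and inhabited levels `17, 19` quantify over a NON-EMPTY type. [cite: Mochizuki2012, IUTchIV Cor. 2.2 (ii) proof (P7) p. 46] -/
theorem nonempty_thetaVolumeDatumAt_exceptional :
    ∀ l ∈ ([11, 13, 17, 19, 37, 43, 67, 163] : List ℕ),
      Nonempty (Cor22.ThetaVolumeDatumAt (ratPoint (((73 : ℕ) : ℚ) / (5973865915867209 : ℕ))) l) :=
  FreyAdm.nonempty_thetaVolumeDatumAt_triple_list (a := 73) (b := 2 ^ 13 * 7 ^ 7 * 941 ^ 2) (c := 5973865915867209)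
    (by unfold IsABCTriple; decide +kernel)
    (Il := [2, 3, 7, 73, 103, 127, 941]) (e := fun p => if p = 2 then 26 else if p = 3 then 32 else if p = 7 then 14 else
      if p = 73 then 2 else if p = 103 then 6 else if p = 127 then 2 else if p = 941 then 4 else 0)
    (by intro p hp; fin_cases hp <;> norm_num) (by decide) (by decide +kernel) (by decide +kernel)
    (by unfold Cor22.coreExceptionalJ; decide +kernel)
    [11, 13, 17, 19, 37, 43, 67, 163]
    (by decide +kernel) condP6_exceptional

/-! ## §3 The 73-triple at EVERY prime level `l ≥ 11`, modulo Mazur 1978 Thm 1 BY NAME -/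

/-- **(P6) at `λ₇₃` at EVERY prime `l ≥ 11`, CONDITIONAL on Mazur 1978 Thm 1 (`hM`)**: at a Mazur prime by `condP6_exceptional`
(unconditional), elsewhere by `FreyP6Engine.condP6_ratPoint_of_mazur` with the multiplicative prime `7` (`ord₇ Δ(E₁) = 14`).
[cite: Mazur1978, Thm 1] [cite: Mochizuki2012, IUTchIV Cor. 2.2 (ii) (P6) p.46] -/
theorem condP6_every_of_mazur (hM : mazur_isogeny_irreducible) :
    ∀ l : ℕ, l.Prime → 11 ≤ l → Cor22.CondP6 (ratPoint (((73 : ℕ) : ℚ) / (5973865915867209 : ℕ))) l := by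
  intro l hl h11
  by_cases hmem : l ∈ ([11, 13, 17, 19, 37, 43, 67, 163] : List ℕ)
  · exact condP6_exceptional l hmem
  · haveI : Fact l.Prime := ⟨hl⟩
    have h7l : ¬ 7 ∣ l := fun h => by
      have := (Nat.prime_dvd_prime_iff_eq (by norm_num : Nat.Prime 7) hl).1 h; omega
    have hk : ¬ l ∣ 14 := FreyP6Engine.not_dvd_of_prime_ge_eleven hl h11 (by simp)
    exact FreyP6Engine.condP6_ratPoint_of_mazur hM 73 5973865915867209 (by norm_num) (by norm_num) (by norm_num) l
      (FreyRef.not_dvd_46080_of_seven_le hl (by omega)) (FreyP6Engine.not_mem_mazurPrimes_of_not_mem h11 hmem)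
      7 (by norm_num) h7l not_dvd_c₄_7 14 (by norm_num) hk _ Δ_eq_7 not_dvd_D_7

/-- **The datum type over `λ₇₃` is INHABITED at EVERY prime level `l ≥ 11`, CONDITIONAL on Mazur 1978 Thm 1 (`hM`)** — so every
`∀ T` verdict of FINDINGS §S/§T.2 on the 73-triple axis (`WRow.licence_frey73_all` `l ≥ 29`, `…_small`, the refutations at `11, 13`,
the type-split at `19`) is non-vacuous at every prime level `l ≥ 11` (unconditionally at the ten levels of `…_exceptional` /
`…_tabulated`). (P2)/(P5)/core/`UP`: every prime `l ≥ 11` passes (`e_p ∈ {26, 32, 14, 2, 6, 2, 4}` has no prime factor `≥ 11`).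
[cite: Mazur1978, Thm 1] [cite: Mochizuki2012, IUTchIV Cor. 2.2 (ii) proof (P7) p. 46] -/
theorem nonempty_thetaVolumeDatumAt_every_of_mazur (hM : mazur_isogeny_irreducible) :
    ∀ l : ℕ, l.Prime → 11 ≤ l →
      Nonempty (Cor22.ThetaVolumeDatumAt (ratPoint (((73 : ℕ) : ℚ) / (5973865915867209 : ℕ))) l) := by
  intro l hl h11
  have hnd : ∀ m ∈ ([2, 4, 6, 8, 14, 16, 18, 32] : List ℕ), ¬ l ∣ m :=
    fun m hm => FreyP6Engine.not_dvd_of_prime_ge_eleven hl h11 hm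
  refine FreyAdm.nonempty_thetaVolumeDatumAt_triple_list (a := 73) (b := 2 ^ 13 * 7 ^ 7 * 941 ^ 2) (c := 5973865915867209)
    (by unfold IsABCTriple; decide +kernel)
    (Il := [2, 3, 7, 73, 103, 127, 941]) (e := fun p => if p = 2 then 26 else if p = 3 then 32 else if p = 7 then 14 else
      if p = 73 then 2 else if p = 103 then 6 else if p = 127 then 2 else if p = 941 then 4 else 0)
    (by intro p hp; fin_cases hp <;> norm_num) (by decide) (by decide +kernel) (by decide +kernel)
    (by unfold Cor22.coreExceptionalJ; decide +kernel)
    [l] ?_ (fun l' hl' => by rw [List.mem_singleton.mp hl']; exact condP6_every_of_mazur hM l hl h11) l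
    (List.mem_singleton.mpr rfl)
  intro l' hl'
  rw [List.mem_singleton.mp hl']
  refine ⟨hl, by omega, ?_, ?_, ?_⟩
  · -- (P2), odd primes: `l ∤ e_p` for `e_p ∈ {32, 14, 2, 6, 2, 4}`
    intro p hp hp2
    simp only [List.mem_cons, List.not_mem_nil, or_false] at hp
    rcases hp with rfl | rfl | rfl | rfl | rfl | rfl | rfl
    · exact absurd rfl hp2
    · simpa using hnd 32 (by simp)
    · simpa using hnd 14 (by simp)
    · simpa using hnd 2 (by simp)
    · simpa using hnd 6 (by simp)
    · simpa using hnd 2 (by simp)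
    · simpa using hnd 4 (by simp)
  · -- (P2) at `2`: `e_2 − 8 = 18`
    intro _ _
    simpa using hnd 18 (by simp)
  · -- (P5): an odd pole different from `l`
    by_cases h73 : l = 73
    · exact ⟨941, by simp, by norm_num, by omega⟩
    · exact ⟨73, by simp, by norm_num, fun h => h73 h.symm⟩

end FreyP6T73

/-! ## §4 The 283-triple `283 + 5¹¹·13² = 2⁸·3⁸·17³`, `λ₂₈₃ = 283/8251953408` (row 8 carrier): EVERY prime level `l ≥ 13`, modulo Mazur -/

namespace FreyP6T283

/-- Every prime `13 ≤ l ≤ 397` is one of the 73 TABULATED levels of the 283-triple (the table's Szpiro-bad prefix is the whole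
prime interval). [folklore] -/
theorem mem_tabulated_of_prime_le :
    ∀ l < 398, 13 ≤ l → l.Prime →
      l ∈ ([13, 17, 19, 23, 29, 31, 37, 41, 43, 47, 53, 59, 61, 67, 71, 73, 79, 83, 89, 97, 101, 103, 107, 109, 113, 127, 131,
        137, 139, 149, 151, 157, 163, 167, 173, 179, 181, 191, 193, 197, 199, 211, 223, 227, 229, 233, 239, 241, 251,
        257, 263, 269, 271, 277, 281, 283, 293, 307, 311, 313, 317, 331, 337, 347, 349, 353, 359, 367, 373, 379, 383,
        389, 397] : List ℕ) := by
  decide +kernel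

/-- **(P6) at `λ₂₈₃` at EVERY prime `l ≥ 13`, CONDITIONAL on Mazur 1978 Thm 1 (`hM`)**: for `l ≤ 397` by the TREE's
`FreyP6T283.condP6_tabulated` (73 certificates-levels, UNCONDITIONAL, BY NAME); for `l > 397 > 163` by
`FreyP6Engine.condP6_ratPoint_of_mazur` with the multiplicative prime `5` (`ord₅ Δ(E₁) = 22`, tree lemmas `Δ_eq_5`, `not_dvd_c₄_5`,
`not_dvd_D_5` BY NAME). [cite: Mazur1978, Thm 1] [cite: Mochizuki2012, IUTchIV Cor. 2.2 (ii) (P6) p.46] -/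
theorem condP6_every_of_mazur (hM : mazur_isogeny_irreducible) :
    ∀ l : ℕ, l.Prime → 13 ≤ l → Cor22.CondP6 (ratPoint (((283 : ℕ) : ℚ) / (8251953408 : ℕ))) l := by
  intro l hl h13
  by_cases h397 : l < 398
  · exact condP6_tabulated l (mem_tabulated_of_prime_le l h397 h13 hl)
  · haveI : Fact l.Prime := ⟨hl⟩
    have h5l : ¬ 5 ∣ l := fun h => by
      have := (Nat.prime_dvd_prime_iff_eq (by norm_num : Nat.Prime 5) hl).1 h; omega
    have hk : ¬ l ∣ 22 := FreyP6Engine.not_dvd_22_of_prime_ge_thirteen hl h13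
    exact FreyP6Engine.condP6_ratPoint_of_mazur hM 283 8251953408 (by norm_num) (by norm_num) (by norm_num) l
      (FreyRef.not_dvd_46080_of_seven_le hl (by omega)) (not_mem_mazurPrimes_of_lt (by omega))
      5 (by norm_num) h5l not_dvd_c₄_5 22 (by norm_num) hk _ Δ_eq_5 not_dvd_D_5

/-- **The datum type over `λ₂₈₃` is INHABITED at EVERY prime level `l ≥ 13`, CONDITIONAL on Mazur 1978 Thm 1 (`hM`)** —
(P2)/(P5)/core/`UP` from `abc = ∏ p^{e_p}` over `[2, 3, 5, 13, 17, 283]`, `e = [16, 16, 22, 4, 6, 2]`: every prime `l ≥ 13` passes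
(unconditionally inhabited at the 73 tabulated levels by `FreyP6T283.nonempty_thetaVolumeDatumAt_tabulated`). `l = 11` is outside:
(P2) fails there (`11 ∣ e₅ = 22`). [cite: Mazur1978, Thm 1] [cite: Mochizuki2012, IUTchIV Cor. 2.2 (ii) proof (P7) p. 46] -/
theorem nonempty_thetaVolumeDatumAt_every_of_mazur (hM : mazur_isogeny_irreducible) :
    ∀ l : ℕ, l.Prime → 13 ≤ l →
      Nonempty (Cor22.ThetaVolumeDatumAt (ratPoint (((283 : ℕ) : ℚ) / (8251953408 : ℕ))) l) := by
  intro l hl h13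
  have hnd : ∀ m ∈ ([2, 4, 6, 8, 14, 16, 18, 32] : List ℕ), ¬ l ∣ m :=
    fun m hm => FreyP6Engine.not_dvd_of_prime_ge_eleven hl (by omega) hm
  refine FreyAdm.nonempty_thetaVolumeDatumAt_triple_list (a := 283) (b := 5 ^ 11 * 13 ^ 2) (c := 8251953408)
    (by unfold IsABCTriple; decide +kernel)
    (Il := [2, 3, 5, 13, 17, 283]) (e := fun p => if p = 2 then 16 else if p = 3 then 16 else if p = 5 then 22 else
      if p = 13 then 4 else if p = 17 then 6 else if p = 283 then 2 else 0)
    (by intro p hp; fin_cases hp <;> norm_num) (by decide) (by decide +kernel) (by decide +kernel)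
    (by unfold Cor22.coreExceptionalJ; decide +kernel)
    [l] ?_ (fun l' hl' => by rw [List.mem_singleton.mp hl']; exact condP6_every_of_mazur hM l hl h13) l
    (List.mem_singleton.mpr rfl)
  intro l' hl'
  rw [List.mem_singleton.mp hl']
  refine ⟨hl, by omega, ?_, ?_, ?_⟩
  · intro p hp hp2
    simp only [List.mem_cons, List.not_mem_nil, or_false] at hp
    rcases hp with rfl | rfl | rfl | rfl | rfl | rfl
    · exact absurd rfl hp2
    · simpa using hnd 16 (by simp)
    · simpa using FreyP6Engine.not_dvd_22_of_prime_ge_thirteen hl h13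
    · simpa using hnd 4 (by simp)
    · simpa using hnd 6 (by simp)
    · simpa using hnd 2 (by simp)
  · intro _ _
    simpa using hnd 8 (by simp)
  · by_cases h283 : l = 283
    · exact ⟨3, by simp, by norm_num, by omega⟩
    · exact ⟨283, by simp, by norm_num, fun h => h283 h.symm⟩

end FreyP6T283


end Summit.ABC.IUTFork.Conditional

end
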